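import Summits.SmoothPoincare4.SmoothPoincare4.Theorems.CongruenceShadowsNilpotentShadowsStandardJohnsonRealisers
import Summits.SmoothPoincare4.SmoothPoincare4.Theorems.CongruenceShadowsNilpotentShadowsStandardJohnsonChains
import HarnessLib

/-!
# Stub `stub_johnsonGenerators` of line `saturated-torsor-descent` for crux
`CongruenceShadows.NilpotentShadowsStandard` (item stmt-SmoothPoincare4-14594)

**Johnson's theorem, generator-wise, in the PRESENTED surface group** (Johnson 1980, Thm 1 with
Lemma 4B): for `g ≥ 3` and pairwise distinct letters `u, v, w` of `S_g` there is an
IA-automorphism `ψ` of `S_g` with `ψ(x) x⁻¹ ≡ ⁅v,w⁆^⟨x,u⟩ ⁅w,u⁆^⟨x,v⟩ ⁅u,v⁆^⟨x,w⟩ (mod γ₃)` for all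
letters `x` (`τ₁(ψ) = u ∧ v ∧ w`).  Assembly: a triple with two letters on one handle is, up to
permutation, `(aᵢ, bᵢ, x_l)` = shift by `i` of a flip of the type I chain; a triple on three
handles is a shift of flips of the type II chain (mixing + type I).  No definitions.
-/

set_option linter.dupNamespace false

open Subgroup Literature.Topology.FourManifolds
open scoped commutatorElement

namespace Summit.SmoothPoincare4.SmoothPoincare4.Theorems.NilpotentShadowsStandard.SaturatedTorsorDescent

/-! ## Assembly: every basis `3`-vector is realised -/

section Assembly

variable {g n : ℕ}

/-- Flipping handle `j` only if the wanted value `c` of its (currently `true`) letters is `false`: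
letters on handle `j` change their type `ε` to `ε == c`. [folklore] -/
theorem realise_flipTo (j : Fin g) (c : Bool) (u v w u' v' w' : Fin g × Bool)
    (hu : u' = (u.1, if u.1 = j then (u.2 == c) else u.2))
    (hv : v' = (v.1, if v.1 = j then (v.2 == c) else v.2))
    (hw : w' = (w.1, if w.1 = j then (w.2 == c) else w.2)) :
    (∃ ψ : SurfaceGroup g ≃* SurfaceGroup g, (∀ s : SurfaceGroup g, ψ s * s⁻¹ ∈ (⊤ : Subgroup (SurfaceGroup g)).lowerCentralSeries 1) ∧ ∀ x : Fin g × Bool, ψ (PresentedGroup.of x : SurfaceGroup g) * (PresentedGroup.of x : SurfaceGroup g)⁻¹ * (⁅(PresentedGroup.of v : SurfaceGroup g), (PresentedGroup.of w : SurfaceGroup g)⁆ ^ (if x.1 = u.1 ∧ x.2 = false ∧ u.2 = true then (1 : ℤ) else if x.1 = u.1 ∧ x.2 = true ∧ u.2 = false then (-1 : ℤ) else 0) * ⁅(PresentedGroup.of w : SurfaceGroup g), (PresentedGroup.of u : SurfaceGroup g)⁆ ^ (if x.1 = v.1 ∧ x.2 = false ∧ v.2 = true then (1 : ℤ) else if x.1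 = v.1 ∧ x.2 = true ∧ v.2 = false then (-1 : ℤ) else 0) * ⁅(PresentedGroup.of u : SurfaceGroup g), (PresentedGroup.of v : SurfaceGroup g)⁆ ^ (if x.1 = w.1 ∧ x.2 = false ∧ w.2 = true then (1 : ℤ) else if x.1 = w.1 ∧ x.2 = true ∧ w.2 = false then (-1 : ℤ) else 0))⁻¹ ∈ (⊤ : Subgroup (SurfaceGroup g)).lowerCentralSeries 2) →
    ∃ ψ : SurfaceGroup g ≃* SurfaceGroup g, (∀ s : SurfaceGroup g, ψ s * s⁻¹ ∈ (⊤ : Subgroup (SurfaceGroup g)).lowerCentralSeries 1) ∧ ∀ x : Fin g × Bool, ψ (PresentedGroup.of x : SurfaceGroup g) * (PresentedGroup.of x : SurfaceGroup g)⁻¹ * (⁅(PresentedGroup.of v' : SurfaceGroup g), (PresentedGroup.of w' : SurfaceGroup g)⁆ ^ (if x.1 = u'.1 ∧ x.2 = false ∧ u'.2 = true then (1 : ℤ) else if x.1 = u'.1 ∧ x.2 = true ∧ u'.2 = false then (-1 : ℤ) else 0) * ⁅(PresentedGroup.of w' : SurfaceGroup g), (PresentedGroup.of u' : SurfaceGroup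 g)⁆ ^ (if x.1 = v'.1 ∧ x.2 = false ∧ v'.2 = true then (1 : ℤ) else if x.1 = v'.1 ∧ x.2 = true ∧ v'.2 = false then (-1 : ℤ) else 0) * ⁅(PresentedGroup.of u' : SurfaceGroup g), (PresentedGroup.of v' : SurfaceGroup g)⁆ ^ (if x.1 = w'.1 ∧ x.2 = false ∧ w'.2 = true then (1 : ℤ) else if x.1 = w'.1 ∧ x.2 = true ∧ w'.2 = false then (-1 : ℤ) else 0))⁻¹ ∈ (⊤ : Subgroup (SurfaceGroup g)).lowerCentralSeries 2 := by
  cases c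
  · exact realise_flip j u v w u' v' w' (by simpa using hu) (by simpa using hv) (by simpa using hw)
  · have eu : u' = u := by rw [hu]; simp
    have ev : v' = v := by rw [hv]; simp
    have ew : w' = w := by rw [hw]; simp
    subst eu ev ew
    exact id

/-- **Type I**: `(a₀, b₀, bⱼ)` is realised for every `j ≠ 0`. [folklore] -/
theorem realise_typeI (j : Fin (n + 3)) (hj : j ≠ 0) :
    ∃ ψ : SurfaceGroup (n + 3) ≃* SurfaceGroup (n + 3), (∀ s : SurfaceGroup (n + 3), ψ s * s⁻¹ ∈ (⊤ : Subgroup (SurfaceGroup (n + 3))).lowerCentralSeries 1) ∧ ∀ x : Fin (n + 3) × Bool, ψ (PresentedGroup.of x : SurfaceGroup (n + 3)) * (PresentedGroup.of x : SurfaceGroup (n + 3))⁻¹ * (⁅(PresentedGroup.of ((0 : Fin (n + 3)), true) : SurfaceGroup (n + 3)), (PresentedGroup.of (j, true) : SurfaceGroup (n + 3))⁆ ^ (if x.1 = ((0 : Fin (n + 3)), false).1 ∧ x.2 = false ∧ ((0 : Fin (n + 3)), false).2 = true then (1 : ℤ) else if x.1 = ((0 : Fin (n + 3)), false).1 ∧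 x.2 = true ∧ ((0 : Fin (n + 3)), false).2 = false then (-1 : ℤ) else 0) * ⁅(PresentedGroup.of (j, true) : SurfaceGroup (n + 3)), (PresentedGroup.of ((0 : Fin (n + 3)), false) : SurfaceGroup (n + 3))⁆ ^ (if x.1 = ((0 : Fin (n + 3)), true).1 ∧ x.2 = false ∧ ((0 : Fin (n + 3)), true).2 = true then (1 : ℤ) else if x.1 = ((0 : Fin (n + 3)), true).1 ∧ x.2 = true ∧ ((0 : Fin (n + 3)), true).2 = false then (-1 : ℤ) else 0) * ⁅(PresentedGroup.of ((0 : Fin (n + 3)), false) : SurfaceGroup (n + 3)), (PresentedGroup.of ((0 : Fin (n + 3)), true) : SurfaceGroup (n + 3))⁆ ^ (if x.1 = (j, true).1 ∧ x.2 = false ∧ (j, true).2 = true then (1 : ℤ) else if x.1 = (j, true).1 ∧ x.2 = true ∧ (j, true).2 = false then (-1 : ℤ) else 0))⁻¹ ∈ (⊤ : Subgroup (SurfaceGroup (n + 3))).lowerCentralSeries 2 :=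
  realise_chainI (realise_swap _ _ _ (realise_bp n)) j hj

/-- **Type II**: `(b₀, bⱼ, b_k)` is realised for all `0 < j < k`. [folklore] -/
theorem realise_typeII (j k : Fin (n + 3)) (hj : j ≠ 0) (hjk : j.val < k.val) :
    ∃ ψ : SurfaceGroup (n + 3) ≃* SurfaceGroup (n + 3), (∀ s : SurfaceGroup (n + 3), ψ s * s⁻¹ ∈ (⊤ : Subgroup (SurfaceGroup (n + 3))).lowerCentralSeries 1) ∧ ∀ x : Fin (n + 3) × Bool, ψ (PresentedGroup.of x : SurfaceGroup (n + 3)) * (PresentedGroup.of x : SurfaceGroup (n + 3))⁻¹ * (⁅(PresentedGroup.of (j, true) : SurfaceGroup (n + 3)), (PresentedGroup.of (k, true) : SurfaceGroup (n + 3))⁆ ^ (if x.1 = ((0 : Fin (n + 3)), true).1 ∧ x.2 = false ∧ ((0 : Fin (n + 3)), true).2 = true then (1 : ℤ) else if x.1 = ((0 : Fin (n + 3)), true).1 ∧ x.2 = true ∧ ((0 : Fin (n + 3)), true).2 = false then (-1 : ℤ) else 0) * ⁅(PresentedGroup.of (k, true) : SurfaceGroup (n + 3)), (PresentedGroup.of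 ((0 : Fin (n + 3)), true) : SurfaceGroup (n + 3))⁆ ^ (if x.1 = (j, true).1 ∧ x.2 = false ∧ (j, true).2 = true then (1 : ℤ) else if x.1 = (j, true).1 ∧ x.2 = true ∧ (j, true).2 = false then (-1 : ℤ) else 0) * ⁅(PresentedGroup.of ((0 : Fin (n + 3)), true) : SurfaceGroup (n + 3)), (PresentedGroup.of (j, true) : SurfaceGroup (n + 3))⁆ ^ (if x.1 = (k, true).1 ∧ x.2 = false ∧ (k, true).2 = true then (1 : ℤ) else if x.1 = (k, true).1 ∧ x.2 = true ∧ (k, true).2 = false then (-1 : ℤ) else 0))⁻¹ ∈ (⊤ : Subgroup (SurfaceGroup (n + 3))).lowerCentralSeries 2 := by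
  have h01 : (0 : Fin (n + 3)) ≠ 1 := (fin_one_ne_zero n).symm
  refine realise_chainII (fun k hk0 hk1 => ?_) j k hj hjk
  exact realise_flip 1 _ _ _ _ _ _ (by simp [h01]) (by simp) (by simp [hk1])
    (realise_mix k hk0 hk1 (realise_swap _ _ _ (realise_typeI k hk0)))

/-- **Case I of the assembly**: two of the three letters on one handle. [folklore] -/
theorem realise_caseI (u v w : Fin (n + 3) × Bool) (huv : u ≠ v) (huw : u ≠ w) (hvw : v ≠ w)
    (h : u.1 = v.1) :
    ∃ ψ : SurfaceGroup (n + 3) ≃* SurfaceGroup (n + 3), (∀ s : SurfaceGroup (n + 3), ψ s * s⁻¹ ∈ (⊤ : Subgroup (SurfaceGroup (n + 3))).lowerCentralSeries 1) ∧ ∀ x : Fin (n + 3) × Bool, ψ (PresentedGroup.of x : SurfaceGroup (n + 3)) * (PresentedGroup.of x : SurfaceGroup (n + 3))⁻¹ * (⁅(PresentedGroup.of v : SurfaceGroup (n + 3)), (PresentedGroup.of w : SurfaceGroup (n + 3))⁆ ^ (if x.1 = u.1 ∧ x.2 = false ∧ u.2 = true then (1 : ℤ) else if x.1 = u.1 ∧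 x.2 = true ∧ u.2 = false then (-1 : ℤ) else 0) * ⁅(PresentedGroup.of w : SurfaceGroup (n + 3)), (PresentedGroup.of u : SurfaceGroup (n + 3))⁆ ^ (if x.1 = v.1 ∧ x.2 = false ∧ v.2 = true then (1 : ℤ) else if x.1 = v.1 ∧ x.2 = true ∧ v.2 = false then (-1 : ℤ) else 0) * ⁅(PresentedGroup.of u : SurfaceGroup (n + 3)), (PresentedGroup.of v : SurfaceGroup (n + 3))⁆ ^ (if x.1 = w.1 ∧ x.2 = false ∧ w.2 = true then (1 : ℤ) else if x.1 = w.1 ∧ x.2 = true ∧ w.2 = false then (-1 : ℤ) else 0))⁻¹ ∈ (⊤ : Subgroup (SurfaceGroup (n + 3))).lowerCentralSeries 2 := by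
  obtain ⟨i, a⟩ := u
  obtain ⟨i', b⟩ := v
  obtain ⟨l, c⟩ := w
  simp only at h
  subst h
  have hab : a ≠ b := fun h => huv (by rw [h])
  have hl : l ≠ i := by
    rintro rfl
    rcases Bool.eq_false_or_eq_true c with hc | hc <;> rcases Bool.eq_false_or_eq_true a with ha | ha <;>
      rcases Bool.eq_false_or_eq_true b with hb | hb <;> simp_all
  have hd : l - i ≠ 0 := sub_ne_zero.2 hl
  have hd' : (0 : Fin (n + 3)) ≠ l - i := hd.symm
  -- `(a_i, b_i, w)` from type I, a flip of handle `l - i` and a shift by `i`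
  have key : ∃ ψ : SurfaceGroup (n + 3) ≃* SurfaceGroup (n + 3), (∀ s : SurfaceGroup (n + 3), ψ s * s⁻¹ ∈ (⊤ : Subgroup (SurfaceGroup (n + 3))).lowerCentralSeries 1) ∧ ∀ x : Fin (n + 3) × Bool, ψ (PresentedGroup.of x : SurfaceGroup (n + 3)) * (PresentedGroup.of x : SurfaceGroup (n + 3))⁻¹ * (⁅(PresentedGroup.of (i, true) : SurfaceGroup (n + 3)), (PresentedGroup.of (l, c) : SurfaceGroup (n + 3))⁆ ^ (if x.1 = (i, false).1 ∧ x.2 = false ∧ (i, false).2 = true then (1 : ℤ) else if x.1 = (i, false).1 ∧ x.2 = true ∧ (i, false).2 = false then (-1 : ℤ) else 0) * ⁅(PresentedGroup.of (l, c) : SurfaceGroup (n + 3)), (PresentedGroup.of (i, false) : SurfaceGroup (n + 3))⁆ ^ (if x.1 = (i, true).1 ∧ x.2 = false ∧ (i, true).2 = true then (1 : ℤ) else if x.1 = (i, true).1 ∧ x.2 = true ∧ (i, true).2 = false then (-1 : ℤ) else 0) * ⁅(PresentedGroup.of (i, false) : SurfaceGroup (n + 3)), (PresentedGroup.of (i,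 true) : SurfaceGroup (n + 3))⁆ ^ (if x.1 = (l, c).1 ∧ x.2 = false ∧ (l, c).2 = true then (1 : ℤ) else if x.1 = (l, c).1 ∧ x.2 = true ∧ (l, c).2 = false then (-1 : ℤ) else 0))⁻¹ ∈ (⊤ : Subgroup (SurfaceGroup (n + 3))).lowerCentralSeries 2 := by
    have f := realise_flipTo (l - i) c _ _ _ (0, false) (0, true) (l - i, c) (by simp [hd']) (by simp [hd'])
      (by simp) (realise_typeI (l - i) hd)
    exact realise_shift i _ _ _ _ _ _ (by simp) (by simp) (by simp) f
  cases a <;> cases b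
  · exact absurd rfl hab
  · exact key
  · exact realise_swap _ _ _ key
  · exact absurd rfl hab

/-- **Case II of the assembly**: three letters on three distinct handles. [folklore] -/
theorem realise_caseII (u v w : Fin (n + 3) × Bool) (h12 : u.1 ≠ v.1) (h13 : u.1 ≠ w.1)
    (h23 : v.1 ≠ w.1) :
    ∃ ψ : SurfaceGroup (n + 3) ≃* SurfaceGroup (n + 3), (∀ s : SurfaceGroup (n + 3), ψ s * s⁻¹ ∈ (⊤ : Subgroup (SurfaceGroup (n + 3))).lowerCentralSeries 1) ∧ ∀ x : Fin (n + 3) × Bool, ψ (PresentedGroup.of x : SurfaceGroup (n + 3)) * (PresentedGroup.of x : SurfaceGroup (n + 3))⁻¹ * (⁅(PresentedGroup.of v : SurfaceGroup (n + 3)), (PresentedGroup.of w : SurfaceGroup (n + 3))⁆ ^ (if x.1 = u.1 ∧ x.2 = false ∧ u.2 = true then (1 : ℤ) else if x.1 = u.1 ∧ x.2 = true ∧ u.2 = false then (-1 : ℤ) else 0) * ⁅(PresentedGroup.of w : SurfaceGroup (n + 3)), (PresentedGroup.of u : SurfaceGroup (n + 3))⁆ ^ (if x.1 = v.1 ∧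 x.2 = false ∧ v.2 = true then (1 : ℤ) else if x.1 = v.1 ∧ x.2 = true ∧ v.2 = false then (-1 : ℤ) else 0) * ⁅(PresentedGroup.of u : SurfaceGroup (n + 3)), (PresentedGroup.of v : SurfaceGroup (n + 3))⁆ ^ (if x.1 = w.1 ∧ x.2 = false ∧ w.2 = true then (1 : ℤ) else if x.1 = w.1 ∧ x.2 = true ∧ w.2 = false then (-1 : ℤ) else 0))⁻¹ ∈ (⊤ : Subgroup (SurfaceGroup (n + 3))).lowerCentralSeries 2 := by
  suffices key : ∀ v w : Fin (n + 3) × Bool, u.1 ≠ v.1 → u.1 ≠ w.1 →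
      (v.1 - u.1).val < (w.1 - u.1).val →
      ∃ ψ : SurfaceGroup (n + 3) ≃* SurfaceGroup (n + 3), (∀ s : SurfaceGroup (n + 3), ψ s * s⁻¹ ∈ (⊤ : Subgroup (SurfaceGroup (n + 3))).lowerCentralSeries 1) ∧ ∀ x : Fin (n + 3) × Bool, ψ (PresentedGroup.of x : SurfaceGroup (n + 3)) * (PresentedGroup.of x : SurfaceGroup (n + 3))⁻¹ * (⁅(PresentedGroup.of v : SurfaceGroup (n + 3)), (PresentedGroup.of w : SurfaceGroup (n + 3))⁆ ^ (if x.1 = u.1 ∧ x.2 = false ∧ u.2 = true then (1 : ℤ) else if x.1 = u.1 ∧ x.2 = true ∧ u.2 = false then (-1 : ℤ) else 0) * ⁅(PresentedGroup.of w : SurfaceGroup (n + 3)), (PresentedGroup.of u : SurfaceGroup (n + 3))⁆ ^ (if x.1 = v.1 ∧ x.2 = false ∧ v.2 = true then (1 : ℤ) else if x.1 = v.1 ∧ x.2 = true ∧ v.2 = false then (-1 : ℤ) else 0) * ⁅(PresentedGroup.of u : SurfaceGroup (n + 3)), (PresentedGroup.of v : SurfaceGroup (n + 3))⁆ ^ (if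 x.1 = w.1 ∧ x.2 = false ∧ w.2 = true then (1 : ℤ) else if x.1 = w.1 ∧ x.2 = true ∧ w.2 = false then (-1 : ℤ) else 0))⁻¹ ∈ (⊤ : Subgroup (SurfaceGroup (n + 3))).lowerCentralSeries 2 by
    have hne : (v.1 - u.1).val ≠ (w.1 - u.1).val := fun h => h23 (sub_left_inj.1 (Fin.ext h))
    rcases lt_or_gt_of_ne hne with hlt | hgt
    · exact key v w h12 h13 hlt
    · exact realise_rotate _ _ _ (realise_swap _ _ _ (key w v h13 h12 hgt))
  intro v w h12 h13 hlt
  have hd1 : v.1 - u.1 ≠ 0 := sub_ne_zero.2 (Ne.symm h12)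
  have hd2 : w.1 - u.1 ≠ 0 := sub_ne_zero.2 (Ne.symm h13)
  have hd12 : v.1 - u.1 ≠ w.1 - u.1 := fun h => (Nat.ne_of_lt hlt) (by rw [h])
  have f0 := realise_flipTo 0 u.2 _ _ _ (0, u.2) (v.1 - u.1, true) (w.1 - u.1, true)
    (by simp) (by simp [hd1]) (by simp [hd2]) (realise_typeII (v.1 - u.1) (w.1 - u.1) hd1 hlt)
  have f1 := realise_flipTo (v.1 - u.1) v.2 _ _ _ (0, u.2) (v.1 - u.1, v.2) (w.1 - u.1, true)
    (by simp [hd1.symm]) (by simp) (by simp [hd12.symm]) f0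
  have f2 := realise_flipTo (w.1 - u.1) w.2 _ _ _ (0, u.2) (v.1 - u.1, v.2) (w.1 - u.1, w.2)
    (by simp [hd2.symm]) (by simp [hd12]) (by simp) f1
  exact realise_shift u.1 _ _ _ u v w (by simp) (by simp) (by simp) f2

end Assembly

/-- **Johnson's generators, presented form** (registered stub `stub_johnsonGenerators`): for
`g ≥ 3` and pairwise distinct letters `u, v, w` of `S_g = ⟨aⱼ, bⱼ ∣ ∏ [aⱼ, bⱼ]⟩` there is an
IA-automorphism `ψ` of the PRESENTED group with `ψ(x) x⁻¹ ≡ ⁅v, w⁆^⟨x,u⟩ ⁅w, u⁆^⟨x,v⟩ ⁅u, v⁆^⟨x,w⟩`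
modulo `γ₃` for every letter `x`, i.e. `τ₁(ψ) = u ∧ v ∧ w`: every basis vector of `Λ³ H` is a
value of the Johnson homomorphism on (IA-automorphisms induced by) the Torelli group
(Johnson 1980, Theorem 1, via the bounding-pair generator of Lemma 4B, its conjugates under handle
permutations / flips / one handle-mixing automorphism, and additivity of `τ₁`).
[cite: Johnson1980AbelianQuotient, Theorem 1] -/
theorem stub_johnsonGenerators : ∀ (g : ℕ), 3 ≤ g → ∀ (u v w : Fin g × Bool), u ≠ v → u ≠ w → v ≠ w → ∃ ψ : Literature.Topology.FourManifolds.SurfaceGroup g ≃* Literature.Topology.FourManifolds.SurfaceGroup g, (∀ s : Literature.Topology.FourManifolds.SurfaceGroup g, ψ s * s⁻¹ ∈ (⊤ : Subgroup (Literature.Topology.FourManifolds.SurfaceGroup g)).lowerCentralSeries 1) ∧ ∀ x : Fin g × Bool, ψ (PresentedGroup.of x : Literature.Topology.FourManifolds.SurfaceGroup g) * (PresentedGroup.of x : Literature.Topology.FourManifolds.SurfaceGroup g)⁻¹ * (⁅(PresentedGroup.of v : Literature.Topology.FourManifolds.SurfaceGroup g), (PresentedGroup.of w : Literature.Topology.FourManifolds.SurfaceGroup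 g)⁆ ^ (if x.1 = u.1 ∧ x.2 = false ∧ u.2 = true then (1 : ℤ) else if x.1 = u.1 ∧ x.2 = true ∧ u.2 = false then (-1 : ℤ) else 0) * ⁅(PresentedGroup.of w : Literature.Topology.FourManifolds.SurfaceGroup g), (PresentedGroup.of u : Literature.Topology.FourManifolds.SurfaceGroup g)⁆ ^ (if x.1 = v.1 ∧ x.2 = false ∧ v.2 = true then (1 : ℤ) else if x.1 = v.1 ∧ x.2 = true ∧ v.2 = false then (-1 : ℤ) else 0) * ⁅(PresentedGroup.of u : Literature.Topology.FourManifolds.SurfaceGroup g), (PresentedGroup.of v : Literature.Topology.FourManifolds.SurfaceGroup g)⁆ ^ (if x.1 = w.1 ∧ x.2 = false ∧ w.2 = true then (1 : ℤ) else if x.1 = w.1 ∧ x.2 = true ∧ w.2 = false then (-1 : ℤ) else 0))⁻¹ ∈ (⊤ : Subgroup (Literature.Topology.FourManifolds.SurfaceGroup g)).lowerCentralSeries 2 := by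
  intro g hg u v w huv huw hvw
  obtain ⟨n, rfl⟩ : ∃ n, g = n + 3 := ⟨g - 3, by omega⟩
  by_cases hI : u.1 = v.1 ∨ u.1 = w.1 ∨ v.1 = w.1
  · rcases hI with h | h | h
    · exact realise_caseI u v w huv huw hvw h
    · exact realise_rotate _ _ _ (realise_swap _ _ _ (realise_caseI u w v huw huv (Ne.symm hvw) h))
    · exact realise_rotate _ _ _ (realise_rotate _ _ _
        (realise_caseI v w u hvw (Ne.symm huv) (Ne.symm huw) h))
  · simp only [not_or] at hI
    obtain ⟨h1, h2, h3⟩ := hI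
    exact realise_caseII u v w h1 h2 h3

end Summit.SmoothPoincare4.SmoothPoincare4.Theorems.NilpotentShadowsStandard.SaturatedTorsorDescent
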